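import Summits.QuantumAdvantage.QuantumAdvantage.Theorems.SosSandwichPseudoBoundedAAClassicalCornerRobust
import Literature.Computability.QuantumComplexity.AaronsonAmbainis
import HarnessLib

/-!
# Crux `PseudoBoundedAA` (stmt-QuantumAdvantage-15237, route SosSandwich) — the classical corner for REAL-VALUED
# decision trees (classical query estimators; the `RealDecisionTree` of the tree's Conjecture-4 vocabulary)

File 5 of the CLASSICAL CORNER of PB-AA (files 1–4: mixtures of Boolean decision trees, `PMF` vocabulary, robust corner,
PB-AA ⟺ randomized shallow `L²`-approximation).  Aaronson–Ambainis' classical simulation (their Thm. 21; the tree's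
`Literature.Computability.QuantumComplexity.RealDecisionTree`, used by `SimTreePB`) outputs a deterministic decision tree
with REAL leaves — a classical query ESTIMATOR.  This file proves that such estimators obey the same `(2, 2)` law:

* `exists_decisionTree_thresholdAt` — thresholding the leaves at any level `v` gives a Boolean tree of no larger depth
  computing `[v ≤ t(x)]`;
* `layerCake` — for a finite set of levels `v₀ < v₁ < ⋯ < v_L` (`Finset.orderEmbOfFin`) and `y` among them,
  `y = v₀ + Σ_{l<L} (v_{l+1} − v_l)·[v_{l+1} ≤ y]` (telescoping);
* `osss_realDecisionTree` — **two-function OSSS for real decision trees**: if `t` has values in `[0,1]` then for every real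
  `g` with `L¹` increments `≤ M`, `2^N Σ t g − (Σ t)(Σ g) ≤ depth(t)·2^N·M/4` (layer cake: `t − v₀` is a mixture of the
  threshold trees with weights `v_{l+1} − v_l ≥ 0` summing to `v_L − v₀ ≤ 1`; then `osss_mixture`);
* `exists_influence_ge_of_realDecisionTree` (`Var ≤ depth·√maxInf/4`), `exists_influence_ge_of_realDecisionTree_sq`
  (`16 Var² ≤ depth²·maxInf`) — every `[0,1]`-valued classical query estimator has an influential variable;
* `exists_influence_ge_of_near_realDecisionTree` — ROBUST form: any real polynomial within a quarter of its variance (`L²`)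
  of a `[0,1]`-valued real decision tree of depth `D` has `4 Var² ≤ D²·maxInf` (so the OUTPUTS of the Aaronson–Ambainis
  simulation, whenever they are `L²`-accurate to half a standard deviation, already certify an influential variable).

Honest label: corner lemmas (OSSS + layer cake); no stub, crux or summit is closed.  Sources: O'Donnell–Saks–Schramm–
Servedio, FOCS 2005, Thm 3.2; Aaronson–Ambainis arXiv:0911.0996, Conj. 4 / Thm. 21.
-/

set_option linter.dupNamespace false

noncomputable section

namespace Summit.QuantumAdvantage.QuantumAdvantage.Theorems.SosSandwich

open Finset Function
open Literature.Computability.Complexity Literature.Computability.QuantumComplexity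

namespace ClassicalCorner

variable {N : ℕ}

/-! ### Threshold trees and the layer-cake decomposition -/

/-- Thresholding the leaves of a real decision tree at level `v` gives a Boolean decision tree of no larger depth computing
`x ↦ [v ≤ t(x)]`. [folklore] -/
theorem exists_decisionTree_thresholdAt (t : RealDecisionTree N) (v : ℝ) :
    ∃ T' : DecisionTree N, T'.depth ≤ t.depth ∧ ∀ x, T'.eval x = decide (v ≤ t.eval x) := by
  induction t with
  | leaf r => exact ⟨DecisionTree.leaf (decide (v ≤ r)), le_rfl, fun x => rfl⟩
  | query i t₀ t₁ ih₀ ih₁ =>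
    obtain ⟨T₀, hd₀, he₀⟩ := ih₀
    obtain ⟨T₁, hd₁, he₁⟩ := ih₁
    refine ⟨DecisionTree.query i T₀ T₁, ?_, fun x => ?_⟩
    · simp only [DecisionTree.depth, RealDecisionTree.depth]
      exact Nat.add_le_add_right (max_le_max hd₀ hd₁) 1
    · simp only [DecisionTree.eval, RealDecisionTree.eval]
      split_ifs with hx
      · exact he₁ x
      · exact he₀ x

/-- **Layer cake over a finite set of levels.** If `s` has `L + 1` elements `v₀ < v₁ < ⋯ < v_L` (`v = s.orderEmbOfFin h`)
and `y ∈ s`, then `y = v₀ + Σ_{l : Fin L} (v_{l+1} − v_l)·[v_{l+1} ≤ y]` (a telescoping sum up to the index of `y`).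
[folklore] -/
theorem layerCake {s : Finset ℝ} {L : ℕ} (h : s.card = L + 1) {y : ℝ} (hy : y ∈ s) :
    y = s.orderEmbOfFin h 0 + ∑ l : Fin L, (s.orderEmbOfFin h l.succ - s.orderEmbOfFin h l.castSucc) *
      (if s.orderEmbOfFin h l.succ ≤ y then (1 : ℝ) else 0) := by
  classical
  set v := s.orderEmbOfFin h with hv
  -- `y = v m` for some `m`
  have hy' : y ∈ Set.range v := by rw [hv, Finset.range_orderEmbOfFin]; exact hy
  obtain ⟨m, rfl⟩ := hy'
  -- extend `v` to `ℕ`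
  let f : ℕ → ℝ := fun i => if hi : i < L + 1 then v ⟨i, hi⟩ else 0
  have hf : ∀ i : Fin (L + 1), v i = f i := fun i => by
    simp only [f, dif_pos i.2]
  have hterm : ∀ l : Fin L, (v l.succ - v l.castSucc) * (if v l.succ ≤ v m then (1 : ℝ) else 0)
      = if (l : ℕ) < m then f ((l : ℕ) + 1) - f l else 0 := by
    intro l
    have hiff : v l.succ ≤ v m ↔ (l : ℕ) < m := by
      rw [v.le_iff_le, Fin.le_def, Fin.val_succ]
      constructor <;> intro hh <;> omega
    by_cases hl : (l : ℕ) < m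
    · rw [if_pos (hiff.mpr hl), if_pos hl, mul_one, hf, hf]
      simp only [Fin.val_succ, Fin.val_castSucc]
    · rw [if_neg (fun hh => hl (hiff.mp hh)), if_neg hl, mul_zero]
  rw [Fintype.sum_congr _ _ hterm]
  rw [Fin.sum_univ_eq_sum_range (fun i => if i < (m : ℕ) then f (i + 1) - f i else 0) L]
  rw [← Finset.sum_filter]
  have hfilter : (Finset.range L).filter (fun i => i < (m : ℕ)) = Finset.range m := by
    ext i
    simp only [Finset.mem_filter, Finset.mem_range]
    constructor
    · intro hh; exact hh.2
    · intro hh; exact ⟨by omega, hh⟩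
  rw [hfilter, Finset.sum_range_sub, hf, hf]
  simp only [Fin.val_zero]
  ring

/-! ### OSSS for real decision trees -/

/-- **Two-function OSSS inequality for REAL decision trees (classical query estimators), sum form.** If the real decision
tree `t` takes values in `[0,1]` and the real function `g` has all `L¹` increments `≤ M`, then
`2^N Σₓ t(x) g(x) − (Σ t)(Σ g) ≤ depth(t)·2^N·M/4`: by the layer cake `t − v₀` is a nonnegative combination of the threshold
trees `[v_{l+1} ≤ t]` (depth `≤ depth t`) with total weight `v_L − v₀ ≤ 1`, and `osss_mixture` applies.
[cite: OdonnellEtAl2005, Thm 3.2] -/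
theorem osss_realDecisionTree (t : RealDecisionTree N) (h01 : ∀ x, 0 ≤ t.eval x ∧ t.eval x ≤ 1)
    (g : (Fin N → Bool) → ℝ) (M : ℝ) (hM : 0 ≤ M)
    (hg : ∀ j : Fin N, ∑ x, |g (update x j true) - g (update x j false)| ≤ M) :
    (2 : ℝ) ^ N * (∑ x, t.eval x * g x) - (∑ x, t.eval x) * (∑ x, g x)
      ≤ (t.depth : ℝ) * (2 : ℝ) ^ N * M / 4 := by
  classical
  -- the finite set of values of `t`
  set s : Finset ℝ := Finset.univ.image t.eval with hsdef
  have hsne : s.Nonempty := by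
    rw [hsdef]; exact (Finset.univ_nonempty.image _)
  have hcard : 0 < s.card := Finset.card_pos.mpr hsne
  obtain ⟨L, hL⟩ : ∃ L, s.card = L + 1 := ⟨s.card - 1, by omega⟩
  set v := s.orderEmbOfFin hL with hvdef
  have hmem : ∀ x, t.eval x ∈ s := fun x => by
    rw [hsdef]; exact Finset.mem_image_of_mem _ (Finset.mem_univ x)
  -- every level `v i` is a value, hence in `[0,1]`
  have hv01 : ∀ i : Fin (L + 1), 0 ≤ v i ∧ v i ≤ 1 := by
    intro i
    have hi : v i ∈ s := Finset.orderEmbOfFin_mem s hL i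
    rw [hsdef, Finset.mem_image] at hi
    obtain ⟨x, -, hx⟩ := hi
    rw [← hx]; exact h01 x
  -- threshold trees
  choose T hTd hTe using fun l : Fin L => exists_decisionTree_thresholdAt t (v l.succ)
  -- weights
  set w : Fin L → ℝ := fun l => v l.succ - v l.castSucc with hwdef
  have hw : ∀ l ∈ (Finset.univ : Finset (Fin L)), 0 ≤ w l := by
    intro l _
    have : v l.castSucc < v l.succ := v.strictMono (Fin.castSucc_lt_succ : l.castSucc < l.succ)
    simp only [hwdef]; linarith
  -- the layer cake: `t(x) − v 0 = Σ_l w_l [T_l accepts x]`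
  have hP : ∀ x, t.eval x - v 0 = ∑ l ∈ (Finset.univ : Finset (Fin L)),
      w l * (if (T l).eval x = true then (1 : ℝ) else 0) := by
    intro x
    have hlc := layerCake hL (hmem x)
    have hterm : ∀ l : Fin L, w l * (if (T l).eval x = true then (1 : ℝ) else 0)
        = (v l.succ - v l.castSucc) * (if v l.succ ≤ t.eval x then (1 : ℝ) else 0) := by
      intro l
      rw [hTe l x]
      simp only [hwdef, decide_eq_true_eq]
    rw [Finset.sum_congr rfl fun l _ => hterm l]
    rw [hvdef]
    linarith [hlc]
  have key := osss_mixture Finset.univ w hw T (fun x => t.eval x - v 0) g hP M hM hg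
  -- total weight `Σ w = v L − v 0 ≤ 1` and every threshold depth `≤ depth t`
  have hsumw : ∑ l ∈ (Finset.univ : Finset (Fin L)), w l * ((T l).depth : ℝ) ≤ (t.depth : ℝ) := by
    have h1 : ∑ l ∈ (Finset.univ : Finset (Fin L)), w l * ((T l).depth : ℝ)
        ≤ ∑ l ∈ (Finset.univ : Finset (Fin L)), w l * (t.depth : ℝ) :=
      Finset.sum_le_sum fun l hl => mul_le_mul_of_nonneg_left (by exact_mod_cast hTd l) (hw l hl)
    have h2 : ∑ l ∈ (Finset.univ : Finset (Fin L)), w l = v (Fin.last L) - v 0 := by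
      obtain ⟨f, hf⟩ : ∃ f : ℕ → ℝ, ∀ i : Fin (L + 1), v i = f i :=
        ⟨fun i => if hi : i < L + 1 then v ⟨i, hi⟩ else 0, fun i => by simp only [dif_pos i.2]⟩
      have hwf : ∀ l : Fin L, w l = f ((l : ℕ) + 1) - f l := by
        intro l
        simp only [hwdef, hf, Fin.val_succ, Fin.val_castSucc]
      rw [Finset.sum_congr rfl fun l _ => hwf l, Fin.sum_univ_eq_sum_range (fun i => f (i + 1) - f i) L,
        Finset.sum_range_sub, hf, hf]
      simp only [Fin.val_last, Fin.val_zero]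
    have h3 : v (Fin.last L) - v 0 ≤ 1 := by
      linarith [(hv01 (Fin.last L)).2, (hv01 0).1]
    calc _ ≤ ∑ l ∈ (Finset.univ : Finset (Fin L)), w l * (t.depth : ℝ) := h1
      _ = (∑ l ∈ (Finset.univ : Finset (Fin L)), w l) * (t.depth : ℝ) := by rw [Finset.sum_mul]
      _ ≤ 1 * (t.depth : ℝ) := by rw [h2]; gcongr
      _ = (t.depth : ℝ) := one_mul _
  -- shift invariance of the covariance form
  have hshift : (2 : ℝ) ^ N * (∑ x, t.eval x * g x) - (∑ x, t.eval x) * (∑ x, g x)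
      = (2 : ℝ) ^ N * (∑ x, (t.eval x - v 0) * g x) - (∑ x, (t.eval x - v 0)) * (∑ x, g x) := by
    have h1 : ∑ x, (t.eval x - v 0) * g x = (∑ x, t.eval x * g x) - v 0 * ∑ x, g x := by
      rw [Finset.mul_sum, ← Finset.sum_sub_distrib]
      exact Finset.sum_congr rfl fun x _ => by ring
    have h2 : ∑ x : Fin N → Bool, (t.eval x - v 0) = (∑ x, t.eval x) - (2 : ℝ) ^ N * v 0 := by
      rw [Finset.sum_sub_distrib, Finset.sum_const, Finset.card_univ, BooleanCorner.card_cube_nat, nsmul_eq_mul]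
      push_cast; ring
    rw [h1, h2]; ring
  rw [hshift]
  have h2N : (0 : ℝ) ≤ (2 : ℝ) ^ N * M / 4 := by positivity
  calc _ ≤ (∑ l ∈ (Finset.univ : Finset (Fin L)), w l * ((T l).depth : ℝ)) * (2 : ℝ) ^ N * M / 4 := key
    _ = (∑ l ∈ (Finset.univ : Finset (Fin L)), w l * ((T l).depth : ℝ)) * ((2 : ℝ) ^ N * M / 4) := by ring
    _ ≤ (t.depth : ℝ) * ((2 : ℝ) ^ N * M / 4) := mul_le_mul_of_nonneg_right hsumw h2N
    _ = (t.depth : ℝ) * (2 : ℝ) ^ N * M / 4 := by ring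

/-! ### Every classical query estimator has an influential variable -/

/-- **OSSS for classical query estimators.** If the real polynomial `p` takes on the cube the values of a `[0,1]`-valued
real decision tree `t` and `Var[p] > 0`, then for the variable `j` of largest influence `Var[p] ≤ depth(t)·√Infⱼ[p]/4`.
[cite: OdonnellEtAl2005, Thm 3.2] [cite: AaronsonAmbainis2014, Conj. 4] -/
theorem exists_influence_ge_of_realDecisionTree (t : RealDecisionTree N)
    (h01 : ∀ x, 0 ≤ t.eval x ∧ t.eval x ≤ 1) (p : MvPolynomial (Fin N) ℝ)
    (hp : ∀ x, evalBool p x = t.eval x) (hv : 0 < boolVariance p) :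
    ∃ j : Fin N, boolVariance p ≤ (t.depth : ℝ) * Real.sqrt (influence j p) / 4 := by
  classical
  rcases Nat.eq_zero_or_pos N with hN0 | hNpos
  · subst hN0
    exact absurd (BooleanCorner.boolVariance_fin_zero p) (ne_of_gt hv)
  have hne : (Finset.univ : Finset (Fin N)).Nonempty := ⟨⟨0, hNpos⟩, Finset.mem_univ _⟩
  obtain ⟨j, -, hj⟩ := Finset.exists_max_image Finset.univ (fun j => influence j p) hne
  refine ⟨j, ?_⟩
  have h2N : (0 : ℝ) < (2 : ℝ) ^ N := by positivity
  have hMj : ∀ j' : Fin N, ∑ x, |evalBool p (update x j' true) - evalBool p (update x j' false)|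
      ≤ (2 : ℝ) ^ N * Real.sqrt (influence j p) := fun j' =>
    (sum_abs_update_le_sqrt_influence p j').trans
      (mul_le_mul_of_nonneg_left (Real.sqrt_le_sqrt (hj j' (Finset.mem_univ _))) h2N.le)
  have key := osss_realDecisionTree t h01 (evalBool p) ((2 : ℝ) ^ N * Real.sqrt (influence j p))
    (by positivity) hMj
  have hpe : ∀ x, t.eval x = evalBool p x := fun x => (hp x).symm
  simp only [hpe] at key
  rw [BooleanCorner.sum_sq_sub_sq_sum_eq] at key
  have key' : (2 : ℝ) ^ N * ((2 : ℝ) ^ N * boolVariance p)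
      ≤ (2 : ℝ) ^ N * ((2 : ℝ) ^ N * ((t.depth : ℝ) * Real.sqrt (influence j p) / 4)) := by
    calc (2 : ℝ) ^ N * ((2 : ℝ) ^ N * boolVariance p)
        ≤ (t.depth : ℝ) * (2 : ℝ) ^ N * ((2 : ℝ) ^ N * Real.sqrt (influence j p)) / 4 := key
      _ = _ := by ring
  exact le_of_mul_le_mul_left (le_of_mul_le_mul_left key' h2N) h2N

/-- Squared form for estimators: `16·Var[p]² ≤ depth(t)²·Infⱼ[p]`. [cite: OdonnellEtAl2005, Thm 3.2] -/
theorem exists_influence_ge_of_realDecisionTree_sq (t : RealDecisionTree N)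
    (h01 : ∀ x, 0 ≤ t.eval x ∧ t.eval x ≤ 1) (p : MvPolynomial (Fin N) ℝ)
    (hp : ∀ x, evalBool p x = t.eval x) (hv : 0 < boolVariance p) :
    ∃ j : Fin N, 16 * boolVariance p ^ 2 ≤ (t.depth : ℝ) ^ 2 * influence j p := by
  obtain ⟨j, hj⟩ := exists_influence_ge_of_realDecisionTree t h01 p hp hv
  refine ⟨j, ?_⟩
  have hI := influence_nonneg j p
  have h4 : 4 * boolVariance p ≤ (t.depth : ℝ) * Real.sqrt (influence j p) := by linarith
  calc 16 * boolVariance p ^ 2 = (4 * boolVariance p) ^ 2 := by ring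
    _ ≤ ((t.depth : ℝ) * Real.sqrt (influence j p)) ^ 2 := pow_le_pow_left₀ (by linarith) h4 2
    _ = (t.depth : ℝ) ^ 2 * influence j p := by rw [mul_pow, Real.sq_sqrt hI]

/-- **Robust estimator corner (pure OSSS).** For ANY real polynomial `p` and ANY `[0,1]`-valued real decision tree `t`
that `L²`-approximates it to a quarter of the variance — `4·E(p − t)² ≤ Var[p]` — some variable has
`4·Var[p]² ≤ depth(t)²·Infⱼ[p]`.  In particular an Aaronson–Ambainis simulation tree that is `L²`-accurate to half a
standard deviation certifies an influential variable of the simulated polynomial.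
[cite: OdonnellEtAl2005, Thm 3.2] [cite: AaronsonAmbainis2014, Thm. 21] -/
theorem exists_influence_ge_of_near_realDecisionTree (t : RealDecisionTree N)
    (h01 : ∀ x, 0 ≤ t.eval x ∧ t.eval x ≤ 1) (p : MvPolynomial (Fin N) ℝ)
    (happrox : 4 * boolAvg (fun x => (evalBool p x - t.eval x) ^ 2) ≤ boolVariance p)
    (hv : 0 < boolVariance p) :
    ∃ j : Fin N, 4 * boolVariance p ^ 2 ≤ (t.depth : ℝ) ^ 2 * influence j p := by
  classical
  rcases Nat.eq_zero_or_pos N with hN0 | hNpos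
  · subst hN0
    exact absurd (BooleanCorner.boolVariance_fin_zero p) (ne_of_gt hv)
  have hne : (Finset.univ : Finset (Fin N)).Nonempty := ⟨⟨0, hNpos⟩, Finset.mem_univ _⟩
  obtain ⟨j, -, hj⟩ := Finset.exists_max_image Finset.univ (fun j => influence j p) hne
  refine ⟨j, ?_⟩
  set g : (Fin N → Bool) → ℝ := evalBool p with hgdef
  set F : (Fin N → Bool) → ℝ := t.eval with hFdef
  set C : ℝ := (2 : ℝ) ^ N with hCdef
  have hC : 0 < C := by rw [hCdef]; positivity
  have hIj := influence_nonneg j p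
  set I : ℝ := influence j p with hIdef
  set D : ℝ := (t.depth : ℝ) with hDdef
  have hD0 : 0 ≤ D := Nat.cast_nonneg _
  have hM : ∀ j' : Fin N, ∑ x, |g (update x j' true) - g (update x j' false)| ≤ C * Real.sqrt I := fun j' =>
    (sum_abs_update_le_sqrt_influence p j').trans
      (mul_le_mul_of_nonneg_left (Real.sqrt_le_sqrt (hj j' (Finset.mem_univ _))) hC.le)
  have key := osss_realDecisionTree t h01 g (C * Real.sqrt I) (by positivity) hM
  set μ : ℝ := (∑ x, g x) / C with hμ
  have hcov : C * (∑ x, F x * g x) - (∑ x, F x) * (∑ x, g x) = C * ∑ x, (F x - μ) * (g x - μ) := by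
    have hsum : ∑ x, (F x - μ) * (g x - μ)
        = (∑ x, F x * g x) - μ * (∑ x, F x) - μ * (∑ x, g x) + C * μ ^ 2 := by
      have h : ∀ x, (F x - μ) * (g x - μ) = F x * g x - μ * F x - μ * g x + μ ^ 2 := fun x => by ring
      rw [Finset.sum_congr rfl fun x _ => h x, Finset.sum_add_distrib, Finset.sum_sub_distrib,
        Finset.sum_sub_distrib, ← Finset.mul_sum, ← Finset.mul_sum, Finset.sum_const, Finset.card_univ,
        BooleanCorner.card_cube_nat, nsmul_eq_mul, hCdef]
      push_cast; ring
    rw [hsum, hμ]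
    field_simp
    ring
  have hVar : ∑ x, (g x - μ) ^ 2 = C * boolVariance p := by
    rw [hμ, hCdef, hgdef]
    unfold boolVariance boolAvg
    rw [mul_div_cancel₀ _ (by positivity : (2 : ℝ) ^ N ≠ 0)]
  have happrox' : 4 * ∑ x, (g x - F x) ^ 2 ≤ ∑ x, (g x - μ) ^ 2 := by
    rw [hVar]
    have h1 : boolAvg (fun x => (evalBool p x - t.eval x) ^ 2) = (∑ x, (g x - F x) ^ 2) / C := by
      rw [hCdef, hgdef, hFdef]; rfl
    rw [h1] at happrox
    have := mul_le_mul_of_nonneg_left happrox hC.le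
    rwa [← mul_assoc, mul_comm C 4, mul_assoc, mul_div_cancel₀ _ hC.ne'] at this
  have hhalf := BooleanCorner.half_var_le_sum_centered_mul F g μ happrox'
  rw [hcov] at key
  rw [hVar] at hhalf
  have h1 : C * (C * boolVariance p / 2) ≤ D * C * (C * Real.sqrt I) / 4 :=
    (mul_le_mul_of_nonneg_left hhalf hC.le).trans key
  have h2 : boolVariance p ≤ D * Real.sqrt I / 2 := by
    have h1' : C * C * boolVariance p ≤ C * C * (D * Real.sqrt I / 2) := by
      calc C * C * boolVariance p = 2 * (C * (C * boolVariance p / 2)) := by ring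
        _ ≤ 2 * (D * C * (C * Real.sqrt I) / 4) := by linarith
        _ = C * C * (D * Real.sqrt I / 2) := by ring
    exact le_of_mul_le_mul_left h1' (by positivity)
  calc 4 * boolVariance p ^ 2 ≤ 4 * (D * Real.sqrt I / 2) ^ 2 := by
        have := pow_le_pow_left₀ hv.le h2 2
        linarith
    _ = D ^ 2 * I := by rw [div_pow, mul_pow, Real.sq_sqrt hIj]; ring

end ClassicalCorner

end Summit.QuantumAdvantage.QuantumAdvantage.Theorems.SosSandwich

end
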